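import Literature.MathematicalPhysics.QuantumFieldTheory.Balaban1983to89.B4Ineq47TwoBlock
import Literature.MathematicalPhysics.QuantumFieldTheory.Balaban1983to89.B4Ineq44MassPart
import Literature.MathematicalPhysics.QuantumFieldTheory.Balaban1983to89.B4Prop31Regular

/-!
# `Balaban1983to89.B4Prop31Sect4Route` — T. Bałaban, *Regularity and decay of lattice Green's functions*, Commun. Math.
# Phys. **89** (1983) 571–597 [Balaban1983RegularityDecay], «Proposition 3.1′ of [2]» (1.21)–(1.22) p. 574 BY THE
# PRINTED ROUTE OF §4 (pp. 589–591): (4.4) + (4.6) + (4.7) on every two-block cell `Δ(x,x′)`, (4.7) ⇐ (4.11)+(4.12)+(4.13)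

statement-level skeleton of published theorems with citation tags; proofs where landed; nothing here is a claim about the Yang–Mills mass gap

PDF held: `paper:balaban1983-cmp89-regularity-decay` (journal page = PDF page + 570); pp. 572–574 [PDF 2–4] and 589–591
[PDF 19–21] read on the text layer and on the ×2 renders `run/shared/lean/pub/pub-balaban/b2b-balaban-ref1/pages/
1983-cmp89-regularity-decay/…-p019-x2.png … -p021-x2.png`.

CITATION HEADER (lean-in-tree rule).  lit-balaban cell (HOME `run/shared/lean/pub/lit-balaban/`), block B4 (fold owner
r01), SKELETON rows **`B4.Prop3.1'[II]`** (= the typed leaf `B4.Prop31Printed`, «Proposition 3.1′ of [2]») and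
**`B4.Eq4.7`**; written by the block's second reader, unit `lit-balaban-r04` gen 13 (free-target protocol, TAKING
2026-08-22T08:26Z, r01 g11 NO OBJECTION in advance).  This is the CLOSING file of the second reader's programme on the
printed §4: `B4Ineq46Lattice` ((4.5)–(4.6), the `2d` matchings) → `B4Ineq44MassPart` ((4.4); «sufficient to prove
(4.7)») → `B4Eq48FirstOrder` ((4.8)) → `B4Eq49TwoBlockGreen` ((4.9)) → `B4Ineq410FirstOrder` ((4.10)) →
`B4Eq47Expansion`/`B4Eq411Remainder` ((4.11)) → `B4Ineq47TwoBlock` ((4.7) on the two-block box ⇐ (4.11)+(4.12)+(4.13),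
with r01's `B4Ineq412ConstField` (4.12)/(4.14) and `B4Ineq410GaugeOut` (4.13)) → THIS FILE (knitting: (4.7) on every cell
`Δ(x,x′)` of a region ⇒ (1.22)).  Inputs USED BY NAME, not re-proved: `B4Ineq47TwoBlock.ineq47_box_canonical`,
`B4Ineq47TwoBlock.lhs47_reindex`, `B4Ineq44MassPart.prop31_region_of_ineq47`, `B4Ineq46Lattice` (`bonds`, `matching`,
`lab`, `bondTerm`, `endSq`), `B4Ineq45Decoupling` (r01's Neumann cells `XC`/`YC`/`cR`/`qR`/`WR`/`TR`/`ψR`/`keffCell`),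
p35's `B4Prop31Energy.keff` (= `Δ^{(k)}(Ω,A)` of (1.14)), `B4Prop31Charts` (`linkR`, `transR`, `covDiffSq`),
`B4Prop31Holonomy` (`clink` = `U(A(⟨x,x′⟩))`, `stair_add`, `transport_pmap`, `abs_sub_nsmul_le`), `B4Prop31Regular`
(`regularFormSetting`), `B4Lower18RegularRegion` (`regWt`, `rBlkWt`, `rbaseEmb`, `rstairContour`, `compField`,
`abs_comp_sub_base_le`), `B4Lower18Regular` (`stair`, `baseEmb`, `stairContour`, `threshold_exists`),
`B4Ineq410FirstOrder` (`lhs47Box`, `outWtB`, `siteX`, `siteX'`), `B4Ineq410GaugeOut.lhs47`, `B4GaugeCovariance`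
((1.3)–(1.6), `boxWt`, `blkWt`, `constBond`, `transport`), `B2Sect3AGaussianStep.one_add_log_inv_rpow_mul_rpow_le`.

## THE PRINT (verbatim up to OCR, `≦` written `≤`)

p. 574 [PDF 4]: *"Proposition 3.1′ of [2]: Let Ω be a sum of unit blocks (i.e. Ω^{(k)} is an arbitrary subset of Z^d)
and let A satisfies the condition |(∂^η_μA)(x)| ≤ O(1)p(e) (p(e) = a₀(1 + log e^{−1})^p), (1.21) then there exists a
positive constant γ₀ depending on d only, such that for e sufficiently small ⟨φ, Δ^{(k)}(Ω,A)φ⟩ ≥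
γ₀(Σ_{⟨x,x′⟩⊂Ω^{(k)}}|U(A(⟨x,x′⟩))φ(x′) − φ(x)|² + m²Σ_{x∈Ω^{(k)}}|φ(x)|²) − O(1)e^{2−α}Σ_{x∈Ω^{(k)}}|φ(x)|² (1.22) for
arbitrary α > 0 and a constant O(1) depending on α and the other constants, but independent of Ω, k, A, and for an
arbitrary function φ."*   p. 590 [PDF 20]: *"Let us denote Δ(x,x′) = B^k(x) ∪ B^k(x′). … (4.6) Now it is easily seen
that to prove (1.18) it is sufficient to prove a_k|φ(x)|² + a_k|φ(x′)|² − a_k²⟨φ, Q_k(A)G_k(Δ(x,x′),A)Q_k^*(A)φ⟩ ≥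
γ₀′|U(A(⟨x,x′⟩))φ(x′) − φ(x)|² − O(1)e²p²(e)(|φ(x)|² + |φ(x′)|²), (4.7) with γ₀′ independent of k, ⟨x,x′⟩, and A. Then
γ₀ = ½ min{γ₀′/2d, a_k/(a_k + O(1))}. … To prove (4.7) for general, regular A we represent A as a sum A₀ + A′, where A₀
is a constant field, A₀ = A(y₀) for some y₀ ∈ Δ(x,x′), and |A′|, |∂^η_μA′| ≤ O(1)p(e) on Δ(x,x′)."*

## WHAT IS CERTIFIED (kernel theorems + definitions with bodies; zero `sorry`, standard axioms; NO `Prop`-valued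
## statement is introduced, no existing declaration is modified)

* §1 `keff_congr` (`Δ^{(k)}` depends on the transporters only on block pairs), **`lhs47_eq_keff_form`** (r01's left side of
  (4.7) `lhs47` with inner coefficient `a·s` and outer weight `r·q`, `r² = s`, IS the quadratic form of p35's
  `keff c m² a s q`: the two (1.14)-dictionaries of the block agree), `transport_comp`.
* §2 the lattice geometry of the cell of a bond `b = ⟨x, x + e_μ⟩ ⊂ Ω^{(k)}`: `blk_add_base`/`blk_sub_base`
  (`blk(z ± n·t) = blk(z) ± t`), `sub_mem_nbrs_sub_iff`, **`stair_add_nsmul`** (the staircase from `u` to `u + m·e_μ` is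
  the straight segment), `cellY_iff`/`cellX_iff` (the cell of `b` in r01's Neumann separation along the matching
  `B_{cls b}` has unit sites `{x, x′}` and fine sites `B^k(x) ∪ B^k(x′)`), and the TRANSLATION EQUIVALENCES
  **`cellEquivY`** (`{x,x′} ≃ {0, e_μ}`, by `−x`) and **`cellEquivX`** (`B^k(x) ∪ B^k(x′) ≃` the fine two-block box
  `□(n·twoBlk μ)` of `B4Ineq410FirstOrder`, by `−n·x`).
* §3 **THE CARRIER BRIDGE `bondTerm_eq_lhs47Box`**: for every bond `b` of `Ω^{(k)}`, the bond term of (4.6) on [B4]'s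
  region model (`B4Ineq46Lattice.bondTerm` = r01's cell operator `Δ^{(k)}(Δ(x,x′),A)` at `φ|_{{x,x′}}`, Neumann weights
  `regWt`, block weights `rBlkWt`, base corners `rbaseEmb`, staircase contours `rstairContour`, `s = n^{−(d+1)}`) EQUALS
  `B4Ineq410FirstOrder.lhs47Box` of the translated field `shiftBond n x A` (`A_x(u,v) = A(u + n·x, v + n·x)`) and the
  translated `φ` (`shiftCfg`) on the two-block box with base-corner block sites and staircase contours — via
  `keff_congr` (the box staircases pulled back to the cell give the region's transporters on block pairs:
  `cell_contourTrans`, by `stair_add`/`transport_pmap`/`transport_comp`), `lhs47_eq_keff_form`, the pointwise identities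
  of the weights (`boxWt_cellEquivX`, `blkWt_cellEquiv`, `outWtB_cellEquiv`) and `lhs47_reindex`.
* §4 `transport_bondContour_shiftBond` (the transporter of `ineq47_box_canonical` along `bondContour` for `A_x` IS
  `U(A(⟨x,x′⟩))` = p35's `clink`, by `stair_add_nsmul`), `bondDiffSq`/`covDiffSq_eq_sum_bonds` (the covariant bond sum
  of the typed carrier is the sum over `B4Ineq46Lattice.bonds`), **`abs_sub_corner_le`** ((1.21) on `Ω` ⇒
  `|A_ν(w) − A_ν(n·x)| ≤ (d+2)nδ` on `Δ(x,x′)`: «A₀ = A(y₀) for some y₀ ∈ Δ(x,x′)» with `y₀ = n·x`),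
  **`shiftBond_sub_const_small`** (hence the bond bound `n|κA′_{uv}| ≤ ε₁ := n|κ|(d+2)nδ` of `ineq47_box_canonical` for
  `A′ = A_x − A₀`).
* §5 **`form122_sect4_lattice`** — (1.22) IN LATTICE UNITS BY THE PRINTED ROUTE with explicit constants: for the flow
  `e^{tq}`, `a_k > 0`, `m² ≥ 0` there are `γ₀ = ½ min{γ₀′/2(d+1), a_k/(a_k+m²)} > 0` (`γ₀′` of
  `ineq47_box_canonical`) and `K = ½C′ ≥ 0` (`C′` the error constant of `ineq47_box_canonical`, which carries the factor `(d+2)²`) such that for every `n ≥ 1`, `κ`, finite `Ω^{(k)}`, `A_ν` with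
  `|A_ν(z+e_μ) − A_ν(z)| ≤ δ` on `Ω`, under the Lemma-2.1 smallness of `ε₁`, and every `φ`:
  `γ₀(Σ_b|U(A(b))φ(x′) − φ(x)|² + m²|φ|²) − Kε₁²|φ|² ≤ ⟨φ, Δ^{(k)}(Ω,A)φ⟩` — (4.7) on each cell (`ineq47_box_canonical`
  through §3–§4) fed into `B4Ineq44MassPart.prop31_region_of_ineq47` ((4.4) + (4.6) + «γ₀ = ½ min{…}»).
* §6 **`prop31Printed_regularRegion_sect4`**: `B4.Prop31Printed (B4Prop31Regular.regularFormSetting (expFlow q hq) a m²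
  C a₀ p)` for `qᵀ = −q`, `a > 0`, `m² ≥ 0`, `C, a₀ ≥ 0`, `p > 0`, with `e₁ = min(1, e₁′)` (`threshold_exists` for
  `ε₁ ≤ (d+2)Ca₀max(1,2p)^p e^{1/2}`) and `O(1) = C(α) = K((d+2)Ca₀)²max(1,2p/α)^{2p}` — a SECOND kernel proof of the
  typed leaf on this family, p35's `B4Prop31Regular.prop31Printed_regularRegion` being the first (global variational
  route, any Lipschitz orthogonal flow); this one is the print's own §4 route, for [B4]'s flow `e^{tq}`.

## DICTIONARY (print ↦ Lean)

`Δ(x,x′) = B^k(x) ∪ B^k(x′)` ↦ the cell `XC (lab Ω (cls b) ∘ rblk) b.1` of r01's Neumann separation (§2) ≃ `boxDom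
(n·twoBlk μ)`; `{x,x′}` ↦ `YC (lab Ω (cls b)) b.1 ≃ boxDom (twoBlk μ)`; `A₀ = A(y₀)`, `y₀ ∈ Δ(x,x′)` ↦ `Ac (base n x)`
(the components at the base corner `n·x`); `A′` ↦ `shiftBond n x (compField Ac) − constBond (Ac (base n x))`;
`U(A(⟨x,x′⟩))` ↦ `clink F κ Ac n x μ`; `O(1)p(e)` (lattice units, per fine bond) ↦ `δ = C·p(e)/n`; `O(1)e p(e)` ↦
`ε₁ = n|κ|(d+2)nδ = (d+2)C·e·p(e)` (`κ = e/n`); `O(1)e²p²(e)` ↦ `Kε₁²`; `O(1)e^{2−α}` ↦ `C(α)e^{2−α}`.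

## HONEST SCOPE / located readings

(a) The flow is [B4]'s abelian `e^{tq}` (the (4.8)–(4.11) chain is proved for it); p35's route covers every Lipschitz
orthogonal flow.  (b) `γ₀` depends on `(d, q, a_k, m²)` — print: «depending on d only»; the dependence on `a_k`, `m²`
is the printed proof's own («a_k/(a_k+O(1))», «if m² ≤ O(1)» at (4.4), `γ₀″` of (4.14)).  (c) `y₀ = n·x` (the base
corner of `B^k(x)`) is ONE admissible choice of the print's «some y₀ ∈ Δ(x,x′)»; the resulting `|A′| ≤ (d+2)·O(1)p(e)`
absorbs the diameter of `Δ(x,x′)` into O(1).  (d) (1.21) is read in lattice units on the fine points of `Ω` exactly as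
in `regularFormSetting.reg121` (p35).  (e) Constants explicit but not optimised.  (f) No existing module is modified;
three `import`s.
-/

namespace Literature.MathematicalPhysics.QuantumFieldTheory.Balaban1983to89.B4Prop31Sect4Route

open Finset Matrix
open Literature.MathematicalPhysics.QuantumFieldTheory.Balaban1983to89.B4GaugeCovariance
open Literature.MathematicalPhysics.QuantumFieldTheory.Balaban1983to89.B4Prop31Energy (keff)
open Literature.MathematicalPhysics.QuantumFieldTheory.Balaban1983to89.B4Ineq410GaugeOut (qgq lhs47)
open Literature.MathematicalPhysics.QuantumFieldTheory.Balaban1983to89.B4Ineq410FirstOrder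
  (outWtB lhs47Box siteX siteX' avgOp_const_mul)
open Literature.MathematicalPhysics.QuantumFieldTheory.Balaban1983to89.B4Eq49TwoBlockGreen
  (twoBlk mem_boxDom_twoBlk zero_mem_boxDom_twoBlk single_mem_boxDom_twoBlk)
open Literature.MathematicalPhysics.QuantumFieldTheory.Balaban1983to89.B4Reflection242 (boxDom mem_boxDom nbrs mem_nbrs blk
  blk_mul)
open Literature.MathematicalPhysics.QuantumFieldTheory.Balaban1983to89.B4Lower18 (fineDom mem_fineDom fineDom_boxDom)
open Literature.MathematicalPhysics.QuantumFieldTheory.Balaban1983to89.B4Lower18Regular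
  (lsum transport_fieldLink PathRel abs_lsum_le baseEmb stairContour e1 e1_apply_self e1_apply_ne add_nsmul_e1_apply
    seg stairL stair raise val_pathEnd_pmap pathRel_pmap_iff dotProduct_self_nonneg' dotProduct_eq_sum_fld
    threshold_exists)
open Literature.MathematicalPhysics.QuantumFieldTheory.Balaban1983to89.B4Lower18RegularRegion
  (regWt rBlkWt rbaseEmb rstairContour rBlkWt_ne_zero compField compField_add compField_sub constBond_step
    constBond_step_rev abs_comp_sub_base_le)
open Literature.MathematicalPhysics.QuantumFieldTheory.Balaban1983to89.B4Ineq45Decoupling (XC YC cR WR qR TR ψR keffCell)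
open Literature.MathematicalPhysics.QuantumFieldTheory.Balaban1983to89.B4Ineq46Lattice
  (bonds mem_bonds cls matching mem_matching lab lab_eq_iff bondTerm sqAt sqAt_of_mem endSq rblk)
open Literature.MathematicalPhysics.QuantumFieldTheory.Balaban1983to89.B4Ineq44MassPart (prop31_region_of_ineq47)
open Literature.MathematicalPhysics.QuantumFieldTheory.Balaban1983to89.B4Ineq47TwoBlock
  (lhs47_reindex ineq47_box_canonical bondContour)
open Literature.MathematicalPhysics.QuantumFieldTheory.Balaban1983to89.B4Lemma21Region (siteNorm)
open Literature.MathematicalPhysics.QuantumFieldTheory.Balaban1983to89.B4Lemma22Reduce231 (siteNorm_sq)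
open Literature.MathematicalPhysics.QuantumFieldTheory.Balaban1983to89.B4Eq12ExpFlow (expFlow)
open Literature.MathematicalPhysics.QuantumFieldTheory.Balaban1983to89.B4Prop31Holonomy
  (base base_add_e1 clink seg_add stair_add transport_pmap blk_base_add_nsmul abs_sub_nsmul_le)
open Literature.MathematicalPhysics.QuantumFieldTheory.Balaban1983to89.B4Prop31Charts (linkR transR covDiffSq)
open Literature.MathematicalPhysics.QuantumFieldTheory.Balaban1983to89.B4Prop31Regular
  (RegularFormInstance regularFormSetting)
open Literature.MathematicalPhysics.QuantumFieldTheory.Balaban1983to89.B2Sect3AGaussianStep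
  (one_add_log_inv_rpow_mul_rpow_le)

noncomputable section

/-! ## §1. Two pieces of generic algebra: `Δ^{(k)}` depends on the transporters only on block pairs; the left side of
(4.7) in r01's normalisation IS the quadratic form of `Δ^{(k)}(Δ, A)` -/

section Generic

variable {X Y ι : Type*} [Fintype X] [Fintype Y] [Fintype ι] [DecidableEq X] [DecidableEq Y] [DecidableEq ι]

/-- `Δ^{(k)} = a·1 − a²s·Q G Qᵀ` depends on the transporters `T(y,x)` only where the block weight `q(y,x)` is non-zero
(both `Q = avgOp q T` and `G = (−Δ + m² + (as)QᵀQ)⁻¹` do). [cite: Balaban1983RegularityDecay, (1.14) p.573, dictionary] -/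
theorem keff_congr (c : X → X → ℝ) (m2 a s : ℝ) {q : Y → X → ℝ} (W : X → X → Matrix ι ι ℝ)
    {T T' : Y → X → Matrix ι ι ℝ} (hT : ∀ y x, q y x ≠ 0 → T y x = T' y x) :
    keff c m2 a s q W T = keff c m2 a s q W T' := by
  unfold keff green covOp projOp
  rw [avgOp_congr hT]

/-- **THE LEFT SIDE OF (4.7) IS THE QUADRATIC FORM OF `Δ^{(k)}(Δ(x,x′),A)`**: with inner coefficient `a·s`, outer block
weight `r·q`, `r² = s` (r01's normalisation: `s = η^{d+1} = n^{−(d+1)}`, `r = n^{−(d+1)/2}`),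
`a_k|φ|² − a_k²⟨φ, Q_k(A)G_k(Δ,A)Q_k^*(A)φ⟩ = ⟨φ, (a·1 − a²s·Q G Qᵀ)φ⟩`, i.e. `lhs47 = ⟨φ, keff φ⟩`.
[cite: Balaban1983RegularityDecay, (1.14) p.573 with (4.7) p.590, dictionary] -/
theorem lhs47_eq_keff_form (F : OrthFlow ι) (κ : ℝ) (c : X → X → ℝ) (m2 a : ℝ) (q : Y → X → ℝ) (emb : Y → X)
    (Γ : Y → X → List X) (A : X → X → ℝ) (Ψ : Y × ι → ℝ) {s r : ℝ} (hr : r * r = s) :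
    lhs47 F κ c m2 (a * s) q (fun y x => r * q y x) emb Γ a A Ψ
      = Ψ ⬝ᵥ (keff c m2 a s q (fieldLink F κ A) (contourTrans (fieldLink F κ A) emb Γ) *ᵥ Ψ) := by
  unfold lhs47 qgq b4Green b4Op keff green
  rw [avgOp_const_mul, Matrix.transpose_smul, Matrix.smul_mul, Matrix.smul_mul, Matrix.mul_smul, smul_smul, hr]
  simp only [Matrix.sub_mulVec, Matrix.smul_mulVec, Matrix.one_mulVec, dotProduct_sub, dotProduct_smul, smul_eq_mul]
  ring

omit [Fintype X] [Fintype Y] [DecidableEq X] [DecidableEq Y] in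
/-- parallel transport of pulled-back link variables is the transport along the image contour (the tree's
`B4Thm19BoxHolderCut.transport_map` read right to left; restated privately to keep this file's import cone small).
[cite: Balaban1983RegularityDecay, (1.4) p.572 «U(A(Γ_{y,x}))», dictionary] -/
private theorem transport_comp {X' : Type*} (f : X' → X) (W : X → X → Matrix ι ι ℝ) (u : X') (l : List X') :
    transport (fun a b => W (f a) (f b)) u l = transport W (f u) (l.map f) := by
  induction l generalizing u with
  | nil => rfl
  | cons y l ih => simp only [List.map_cons, transport, ih]

end Generic

/-! ## §2. Lattice geometry of the two-block cell `Δ(x,x′) = B^k(x) ∪ B^k(x′)` of a bond `⟨x, x′ = x + e_μ⟩ ⊂ Ω^{(k)}`: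
translation by `x` (unit lattice) and by `n·x` (fine lattice) onto the two-block box of `B4Ineq410FirstOrder` -/

section Geometry

variable {d : ℕ}

/-- block labels translate: `blk(z + n·t) = blk(z) + t`. [cite: Balaban1983RegularityDecay, (1.1) p.572, dictionary] -/
theorem blk_add_base {n : ℕ} (hn : 1 ≤ n) (z t : Fin (d + 1) → ℤ) : blk n (z + base n t) = blk n z + t := by
  have hn0 : (n : ℤ) ≠ 0 := by exact_mod_cast (Nat.one_le_iff_ne_zero.1 hn)
  funext i
  show (z i + (n : ℤ) * t i) / (n : ℤ) = z i / (n : ℤ) + t i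
  rw [Int.add_mul_ediv_left _ _ hn0]

/-- block labels translate: `blk(z − n·t) = blk(z) − t`. [cite: Balaban1983RegularityDecay, (1.1) p.572, dictionary] -/
theorem blk_sub_base {n : ℕ} (hn : 1 ≤ n) (z t : Fin (d + 1) → ℤ) : blk n (z - base n t) = blk n z - t := by
  have h := blk_add_base hn (z - base n t) t
  rw [sub_add_cancel] at h
  rw [h, add_sub_cancel_right]

/-- nearest neighbours translate. [cite: Balaban1983RegularityDecay, (1.3) p.572, dictionary] -/
theorem sub_mem_nbrs_sub_iff (u v t : Fin (d + 1) → ℤ) : v - t ∈ nbrs (u - t) ↔ v ∈ nbrs u := by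
  rw [mem_nbrs, mem_nbrs]
  refine exists_congr fun i => ?_
  rw [show u - t + Pi.single i 1 = (u + Pi.single i 1) - t by abel,
    show u - t - Pi.single i 1 = (u - Pi.single i 1) - t by abel, sub_left_inj, sub_left_inj]

/-- `stairL x x cs = []`: no coordinate needs raising. [cite: Balaban1983RegularityDecay, p.572 «Γ^{(k)}_{y,x}», dictionary] -/
private theorem stairL_self (x : Fin (d + 1) → ℤ) : ∀ cs : List (Fin (d + 1)), stairL x x cs = [] := by
  intro cs
  induction cs with
  | nil => rfl
  | cons i cs ih =>
      have hr : raise x x i = x := by rw [raise, sub_self, Int.toNat_zero, zero_nsmul, add_zero]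
      rw [stairL, sub_self, Int.toNat_zero, seg, hr, ih]
      rfl

/-- the staircase towards `u + m·e_μ` through a coordinate list containing `μ` is the straight segment.
[cite: Balaban1983RegularityDecay, p.572 «Γ^{(k)}_{y,x}», dictionary] -/
private theorem stairL_add_nsmul (u : Fin (d + 1) → ℤ) (μ : Fin (d + 1)) (m : ℕ) :
    ∀ cs : List (Fin (d + 1)), μ ∈ cs → stairL (u + m • e1 μ) u cs = seg μ u m := by
  intro cs
  induction cs with
  | nil => intro h; simp at h
  | cons i cs ih =>
      intro hμ
      by_cases hi : i = μ
      · subst hi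
        have hd : ((u + m • e1 i) i - u i).toNat = m := by
          rw [add_nsmul_e1_apply, if_pos rfl]; simp
        have hr : raise (u + m • e1 i) u i = u + m • e1 i := by rw [raise, hd]
        rw [stairL, hd, hr, stairL_self, List.append_nil]
      · have hμ' : μ ∈ cs := by
          rcases List.mem_cons.1 hμ with h | h
          · exact absurd h.symm hi
          · exact h
        have hd : ((u + m • e1 μ) i - u i).toNat = 0 := by
          rw [add_nsmul_e1_apply, if_neg hi]; simp
        have hr : raise (u + m • e1 μ) u i = u := by rw [raise, hd, zero_nsmul, add_zero]
        rw [stairL, hd, seg, hr, List.nil_append, ih hμ']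

/-- **the staircase `Γ` from `u` to `u + m·e_μ` IS the straight segment of `m` steps in direction `μ`** (the bond
contour `⟨x,x′⟩` of the unit lattice as a fine contour). [cite: Balaban1983RegularityDecay, p.572 «Γ^{(k)}_{y,x}», p.590 «U(A(⟨x,x′⟩))», dictionary] -/
theorem stair_add_nsmul (u : Fin (d + 1) → ℤ) (μ : Fin (d + 1)) (m : ℕ) : stair u (u + m • e1 μ) = seg μ u m :=
  stairL_add_nsmul u μ m _ (List.mem_finRange μ)

variable {Ω : Finset (Fin (d + 1) → ℤ)} {b : ↥Ω × Fin (d + 1)}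

/-- a bond lies in its own matching `B_{cls b}`. [cite: Balaban1983RegularityDecay, p.589 «2d subsets B_i»] -/
theorem mem_matching_cls (hb : b ∈ bonds Ω) : b ∈ matching Ω (cls b) := mem_matching.2 ⟨hb, rfl⟩

/-- THE UNIT SITES OF THE CELL of the bond `b = ⟨x,x′⟩` in the Neumann separation along `B_{cls b}` are `x` and `x′`.
[cite: Balaban1983RegularityDecay, p.589 «Δ(x,x′) = B^k(x) ∪ B^k(x′)»] -/
theorem cellY_iff (hb : b ∈ bonds Ω) (y : ↥Ω) : lab Ω (cls b) y = b.1 ↔ (y.1 = b.1.1 ∨ y.1 = b.1.1 + e1 b.2) := by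
  rw [lab_eq_iff (mem_matching_cls hb)]
  exact or_congr ⟨fun h => congrArg Subtype.val h, fun h => Subtype.ext h⟩ Iff.rfl

/-- THE FINE SITES OF THE CELL of the bond `b = ⟨x,x′⟩` are those of `B^k(x) ∪ B^k(x′)`.
[cite: Balaban1983RegularityDecay, p.589 «Δ(x,x′) = B^k(x) ∪ B^k(x′)»] -/
theorem cellX_iff {n : ℕ} (hn : 1 ≤ n) (hb : b ∈ bonds Ω) (x : ↥(fineDom n Ω)) :
    (lab Ω (cls b) ∘ rblk hn Ω) x = b.1 ↔ (blk n x.1 = b.1.1 ∨ blk n x.1 = b.1.1 + e1 b.2) := by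
  rw [Function.comp_apply, cellY_iff hb]
  rfl

/-- the translate `z − x` of a unit site of the cell is a label of the two-block box `{0, e_μ}`.
[cite: Balaban1983RegularityDecay, p.589 «Δ(x,x′)», dictionary] -/
theorem sub_mem_boxDom_twoBlk (hb : b ∈ bonds Ω) (y : YC (lab Ω (cls b)) b.1) : y.1.1 - b.1.1 ∈ boxDom (twoBlk b.2) := by
  rw [mem_boxDom_twoBlk]
  rcases (cellY_iff hb y.1).1 y.2 with h | h
  · exact Or.inl (by rw [h, sub_self])
  · exact Or.inr (by rw [h, add_sub_cancel_left]; rfl)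

/-- the translate `z + x` of a label of the two-block box is a unit site of `Ω`.
[cite: Balaban1983RegularityDecay, p.589 «Δ(x,x′)», dictionary] -/
theorem add_mem_of_boxDom_twoBlk (hb : b ∈ bonds Ω) (z : ↥(boxDom (twoBlk b.2))) : z.1 + b.1.1 ∈ Ω := by
  rcases mem_boxDom_twoBlk.1 z.2 with h | h
  · rw [h, zero_add]; exact b.1.2
  · rw [h, add_comm (Pi.single b.2 (1 : ℤ)) b.1.1]; exact mem_bonds.1 hb

/-- … and it lies in the cell of `b`. [cite: Balaban1983RegularityDecay, p.589 «Δ(x,x′)», dictionary] -/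
theorem lab_add_of_boxDom_twoBlk (hb : b ∈ bonds Ω) (z : ↥(boxDom (twoBlk b.2))) :
    lab Ω (cls b) ⟨z.1 + b.1.1, add_mem_of_boxDom_twoBlk hb z⟩ = b.1 := by
  rw [cellY_iff hb]
  rcases mem_boxDom_twoBlk.1 z.2 with h | h
  · exact Or.inl (by simp only [h, zero_add])
  · exact Or.inr (by simp only [h]; rw [add_comm (Pi.single b.2 (1 : ℤ)) b.1.1]; rfl)

/-- **THE UNIT SITES OF THE CELL `Δ(x,x′)` ≃ THE LABELS `{0, e_μ}` OF THE TWO-BLOCK BOX**, by translation by `x`.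
[cite: Balaban1983RegularityDecay, p.589 «Δ(x,x′) = B^k(x) ∪ B^k(x′)», dictionary] -/
def cellEquivY (hb : b ∈ bonds Ω) : YC (lab Ω (cls b)) b.1 ≃ ↥(boxDom (twoBlk b.2)) where
  toFun y := ⟨y.1.1 - b.1.1, sub_mem_boxDom_twoBlk hb y⟩
  invFun z := ⟨⟨z.1 + b.1.1, add_mem_of_boxDom_twoBlk hb z⟩, lab_add_of_boxDom_twoBlk hb z⟩
  left_inv y := Subtype.ext (Subtype.ext (by simp only [sub_add_cancel]))
  right_inv z := Subtype.ext (by simp only [add_sub_cancel_right])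

/-- value of the unit-site translation. [cite: Balaban1983RegularityDecay, p.589 «Δ(x,x′)», dictionary] -/
@[simp] theorem cellEquivY_apply_val (hb : b ∈ bonds Ω) (y : YC (lab Ω (cls b)) b.1) :
    (cellEquivY hb y).1 = y.1.1 - b.1.1 := rfl

/-- value of the inverse unit-site translation. [cite: Balaban1983RegularityDecay, p.589 «Δ(x,x′)», dictionary] -/
@[simp] theorem cellEquivY_symm_apply_val (hb : b ∈ bonds Ω) (z : ↥(boxDom (twoBlk b.2))) :
    ((cellEquivY hb).symm z).1.1 = z.1 + b.1.1 := rfl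

/-- the translate `u − n·x` of a fine site of the cell lies in the fine two-block box `Δ(0, e_μ)`.
[cite: Balaban1983RegularityDecay, p.589 «Δ(x,x′) = B^k(x) ∪ B^k(x′)», dictionary] -/
theorem sub_mem_boxDom_fine {n : ℕ} (hn : 1 ≤ n) (hb : b ∈ bonds Ω) (x : XC (lab Ω (cls b) ∘ rblk hn Ω) b.1) :
    x.1.1 - base n b.1.1 ∈ boxDom (fun i => n * twoBlk b.2 i) := by
  rw [← fineDom_boxDom hn, mem_fineDom hn, blk_sub_base hn, mem_boxDom_twoBlk]
  rcases (cellX_iff hn hb x.1).1 x.2 with h | h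
  · exact Or.inl (by rw [h, sub_self])
  · exact Or.inr (by rw [h, add_sub_cancel_left]; rfl)

/-- the translate `u + n·x` of a fine site of the two-block box lies in the fine region over `Ω`.
[cite: Balaban1983RegularityDecay, p.589 «Δ(x,x′) = B^k(x) ∪ B^k(x′)», dictionary] -/
theorem blk_add_of_boxDom_fine {n : ℕ} (hn : 1 ≤ n) (b : ↥Ω × Fin (d + 1))
    (z : ↥(boxDom (fun i => n * twoBlk b.2 i))) :
    blk n (z.1 + base n b.1.1) = b.1.1 ∨ blk n (z.1 + base n b.1.1) = b.1.1 + e1 b.2 := by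
  have hz : z.1 ∈ fineDom n (boxDom (twoBlk b.2)) := by rw [fineDom_boxDom hn]; exact z.2
  rw [mem_fineDom hn, mem_boxDom_twoBlk] at hz
  rw [blk_add_base hn]
  rcases hz with h | h
  · exact Or.inl (by rw [h, zero_add])
  · exact Or.inr (by rw [h, add_comm (Pi.single b.2 (1 : ℤ)) b.1.1]; rfl)

/-- … hence in the fine region. [cite: Balaban1983RegularityDecay, p.589 «Δ(x,x′)», dictionary] -/
theorem add_mem_fineDom_of_boxDom_fine {n : ℕ} (hn : 1 ≤ n) (hb : b ∈ bonds Ω)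
    (z : ↥(boxDom (fun i => n * twoBlk b.2 i))) : z.1 + base n b.1.1 ∈ fineDom n Ω := by
  rw [mem_fineDom hn]
  rcases blk_add_of_boxDom_fine hn b z with h | h
  · rw [h]; exact b.1.2
  · rw [h]; exact mem_bonds.1 hb

/-- … and in the cell of `b`. [cite: Balaban1983RegularityDecay, p.589 «Δ(x,x′)», dictionary] -/
theorem lab_add_of_boxDom_fine {n : ℕ} (hn : 1 ≤ n) (hb : b ∈ bonds Ω) (z : ↥(boxDom (fun i => n * twoBlk b.2 i))) :
    (lab Ω (cls b) ∘ rblk hn Ω) ⟨z.1 + base n b.1.1, add_mem_fineDom_of_boxDom_fine hn hb z⟩ = b.1 :=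
  (cellX_iff hn hb _).2 (blk_add_of_boxDom_fine hn b z)

/-- **THE FINE SITES OF THE CELL `Δ(x,x′)` ≃ THE FINE TWO-BLOCK BOX `Δ(0,e_μ)`**, by translation by `n·x`.
[cite: Balaban1983RegularityDecay, p.589 «Δ(x,x′) = B^k(x) ∪ B^k(x′)», dictionary] -/
def cellEquivX {n : ℕ} (hn : 1 ≤ n) (hb : b ∈ bonds Ω) :
    XC (lab Ω (cls b) ∘ rblk hn Ω) b.1 ≃ ↥(boxDom (fun i => n * twoBlk b.2 i)) where
  toFun x := ⟨x.1.1 - base n b.1.1, sub_mem_boxDom_fine hn hb x⟩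
  invFun z := ⟨⟨z.1 + base n b.1.1, add_mem_fineDom_of_boxDom_fine hn hb z⟩, lab_add_of_boxDom_fine hn hb z⟩
  left_inv x := Subtype.ext (Subtype.ext (by simp only [sub_add_cancel]))
  right_inv z := Subtype.ext (by simp only [add_sub_cancel_right])

/-- value of the fine-site translation. [cite: Balaban1983RegularityDecay, p.589 «Δ(x,x′)», dictionary] -/
@[simp] theorem cellEquivX_apply_val {n : ℕ} (hn : 1 ≤ n) (hb : b ∈ bonds Ω) (x : XC (lab Ω (cls b) ∘ rblk hn Ω) b.1) :
    (cellEquivX hn hb x).1 = x.1.1 - base n b.1.1 := rfl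

/-- value of the inverse fine-site translation. [cite: Balaban1983RegularityDecay, p.589 «Δ(x,x′)», dictionary] -/
@[simp] theorem cellEquivX_symm_apply_val {n : ℕ} (hn : 1 ≤ n) (hb : b ∈ bonds Ω)
    (z : ↥(boxDom (fun i => n * twoBlk b.2 i))) : ((cellEquivX hn hb).symm z).1.1 = z.1 + base n b.1.1 := rfl

end Geometry

/-! ## §3. THE CARRIER BRIDGE: the bond term of (4.6) (r01's Neumann cell operator `Δ^{(k)}(Δ(x,x′),A)` on the cell of
the matching containing `⟨x,x′⟩`) IS the left side of (4.7) on the two-block box of `B4Ineq410FirstOrder`, for the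
translated data -/

section Bridge

variable {d : ℕ} {ι : Type} [Fintype ι] [DecidableEq ι]
variable {Ω : Finset (Fin (d + 1) → ℤ)} {b : ↥Ω × Fin (d + 1)}

/-- **THE VECTOR FIELD SEEN FROM THE BOND**: the bond function `A` translated by `n·x` to the fine box over `{0, e_μ}`,
`A_x(u, v) = A(u + n·x, v + n·x)`. [cite: Balaban1983RegularityDecay, p.590 «To prove (4.7) for general, regular A … on Δ(x,x′)», dictionary] -/
def shiftBond (n : ℕ) (x₀ : Fin (d + 1) → ℤ) (A : (Fin (d + 1) → ℤ) → (Fin (d + 1) → ℤ) → ℝ) (N : Fin (d + 1) → ℕ) :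
    ↥(boxDom N) → ↥(boxDom N) → ℝ :=
  fun u v => A (u.1 + base n x₀) (v.1 + base n x₀)

/-- **THE UNIT-LATTICE FIELD SEEN FROM THE BOND**: `φ|_{{x,x′}}` translated by `x` to the labels `{0, e_μ}` of the
two-block box. [cite: Balaban1983RegularityDecay, (4.7) p.590 «φ(x)», «φ(x′)», dictionary] -/
def shiftCfg (hb : b ∈ bonds Ω) (ψ : ↥Ω × ι → ℝ) : ↥(boxDom (twoBlk b.2)) × ι → ℝ :=
  fun p => ψ (((cellEquivY hb).symm p.1).1, p.2)

omit [Fintype ι] [DecidableEq ι] in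
/-- the translated field at the label `0` is `φ(x)`. [cite: Balaban1983RegularityDecay, (4.7) p.590 «φ(x)», dictionary] -/
theorem fld_shiftCfg_siteX (hb : b ∈ bonds Ω) (ψ : ↥Ω × ι → ℝ) : fld (shiftCfg hb ψ) (siteX b.2) = fld ψ b.1 := by
  funext i
  simp only [fld, shiftCfg]
  congr 2
  exact Subtype.ext (by rw [cellEquivY_symm_apply_val]; exact zero_add _)

omit [Fintype ι] [DecidableEq ι] in
/-- the translated field at the label `e_μ` is `φ(x′)`. [cite: Balaban1983RegularityDecay, (4.7) p.590 «φ(x′)», dictionary] -/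
theorem fld_shiftCfg_siteX' (hb : b ∈ bonds Ω) (ψ : ↥Ω × ι → ℝ) :
    fld (shiftCfg hb ψ) (siteX' b.2) = fld ψ ⟨b.1.1 + e1 b.2, mem_bonds.1 hb⟩ := by
  funext i
  simp only [fld, shiftCfg]
  congr 2
  exact Subtype.ext (by rw [cellEquivY_symm_apply_val]; exact add_comm _ _)

omit [Fintype ι] [DecidableEq ι] in
/-- the Neumann bond weights of the cell are those of the box. [cite: Balaban1983RegularityDecay, (1.3) p.572, dictionary] -/
theorem boxWt_cellEquivX {n : ℕ} (hn : 1 ≤ n) (hb : b ∈ bonds Ω) (u v : XC (lab Ω (cls b) ∘ rblk hn Ω) b.1) :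
    boxWt n (fun i => n * twoBlk b.2 i) (cellEquivX hn hb u) (cellEquivX hn hb v) = regWt n (fineDom n Ω) u.1 v.1 := by
  unfold boxWt regWt
  simp only [cellEquivX_apply_val, sub_mem_nbrs_sub_iff]

omit [Fintype ι] [DecidableEq ι] in
/-- the block weights of the cell are those of the box. [cite: Balaban1983RegularityDecay, (1.4) p.572, dictionary] -/
theorem blkWt_cellEquiv {n : ℕ} (hn : 1 ≤ n) (hb : b ∈ bonds Ω) (y : YC (lab Ω (cls b)) b.1)
    (x : XC (lab Ω (cls b) ∘ rblk hn Ω) b.1) :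
    blkWt n (twoBlk b.2) (fun i => n * twoBlk b.2 i) (cellEquivY hb y) (cellEquivX hn hb x)
      = rBlkWt n Ω (fineDom n Ω) y.1 x.1 := by
  unfold blkWt rBlkWt
  simp only [cellEquivX_apply_val, cellEquivY_apply_val, blk_sub_base hn, sub_left_inj]

omit [Fintype ι] [DecidableEq ι] in
/-- the outer weight of (4.7) on the cell is `n^{−(d+1)/2}` times the block weight. [cite: Balaban1983RegularityDecay, (1.4) p.572, (4.7) p.590, dictionary] -/
theorem outWtB_cellEquiv {n : ℕ} (hn : 1 ≤ n) (hb : b ∈ bonds Ω) (y : YC (lab Ω (cls b)) b.1)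
    (x : XC (lab Ω (cls b) ∘ rblk hn Ω) b.1) :
    outWtB n b.2 (cellEquivY hb y) (cellEquivX hn hb x)
      = (Real.sqrt ((n : ℝ) ^ (d + 1)))⁻¹ * rBlkWt n Ω (fineDom n Ω) y.1 x.1 := by
  unfold outWtB
  rw [blkWt_cellEquiv hn hb]

/-- **THE TRANSPORTERS OF THE CELL ARE THOSE OF THE BOX**: on a block pair `(y, x ∈ B(y))` the staircase transporter
`U(A(Γ^{(k)}_{y,x}))` of the region equals the transporter of the translated field along the box staircase, pulled
back to the cell (both are the transport along `stair (n·y) x` of the raw lattice: `stair_add`).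
[cite: Balaban1983RegularityDecay, (1.4) p.572 «U(A(Γ^{(k)}_{y,x}))», dictionary] -/
theorem cell_contourTrans {n : ℕ} (hn : 1 ≤ n) (hb : b ∈ bonds Ω) (F : OrthFlow ι) (κ : ℝ)
    (A : (Fin (d + 1) → ℤ) → (Fin (d + 1) → ℤ) → ℝ) (y : YC (lab Ω (cls b)) b.1)
    (x : XC (lab Ω (cls b) ∘ rblk hn Ω) b.1)
    (hyx : qR (lab Ω (cls b) ∘ rblk hn Ω) (lab Ω (cls b)) (rBlkWt n Ω (fineDom n Ω)) b.1 y x ≠ 0) :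
    TR (lab Ω (cls b) ∘ rblk hn Ω) (lab Ω (cls b))
        (contourTrans (fieldLink F κ fun u v : ↥(fineDom n Ω) => A u.1 v.1) (rbaseEmb hn Ω) (rstairContour hn Ω)) b.1 y x
      = contourTrans (fieldLink F κ fun u v : XC (lab Ω (cls b) ∘ rblk hn Ω) b.1 => A u.1.1 v.1.1)
          (fun y => (cellEquivX hn hb).symm (baseEmb hn (twoBlk b.2) (cellEquivY hb y)))
          (fun y x => (stairContour hn (twoBlk b.2) (cellEquivY hb y) (cellEquivX hn hb x)).map (cellEquivX hn hb).symm)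
          y x := by
  have hblk : blk n x.1.1 = y.1.1 := rBlkWt_ne_zero hyx
  have hblk' : blk n (cellEquivX hn hb x).1 = (cellEquivY hb y).1 := by
    rw [cellEquivX_apply_val, cellEquivY_apply_val, blk_sub_base hn, hblk]
  -- left: the region staircase, as a transport on the raw lattice
  have hL : TR (lab Ω (cls b) ∘ rblk hn Ω) (lab Ω (cls b))
      (contourTrans (fieldLink F κ fun u v : ↥(fineDom n Ω) => A u.1 v.1) (rbaseEmb hn Ω) (rstairContour hn Ω)) b.1 y x
      = transport (fieldLink F κ A) (base n y.1.1) (stair (base n y.1.1) x.1.1) := by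
    show contourTrans (fun u v : ↥(fineDom n Ω) => fieldLink F κ A u.1 v.1) (rbaseEmb hn Ω) (rstairContour hn Ω) y.1 x.1 = _
    rw [contourTrans, rstairContour, dif_pos hblk]
    exact transport_pmap (fieldLink F κ A) _ _ _ _
  -- right: the box staircase pulled back, as a transport on the raw lattice
  have hW : (fieldLink F κ fun u v : XC (lab Ω (cls b) ∘ rblk hn Ω) b.1 => A u.1.1 v.1.1)
      = fun u v => (fun p r : ↥(boxDom (fun i => n * twoBlk b.2 i)) =>
          (fun s t : Fin (d + 1) → ℤ => fieldLink F κ A (s + base n b.1.1) (t + base n b.1.1)) p.1 r.1)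
          (cellEquivX hn hb u) (cellEquivX hn hb v) := by
    funext u v
    simp only [cellEquivX_apply_val, sub_add_cancel]
    rfl
  have hR : contourTrans (fieldLink F κ fun u v : XC (lab Ω (cls b) ∘ rblk hn Ω) b.1 => A u.1.1 v.1.1)
      (fun y => (cellEquivX hn hb).symm (baseEmb hn (twoBlk b.2) (cellEquivY hb y)))
      (fun y x => (stairContour hn (twoBlk b.2) (cellEquivY hb y) (cellEquivX hn hb x)).map (cellEquivX hn hb).symm) y x
      = transport (fieldLink F κ A) (base n y.1.1) (stair (base n y.1.1) x.1.1) := by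
    rw [contourTrans, hW,
      transport_comp (cellEquivX hn hb) (fun p r : ↥(boxDom (fun i => n * twoBlk b.2 i)) =>
        (fun s t : Fin (d + 1) → ℤ => fieldLink F κ A (s + base n b.1.1) (t + base n b.1.1)) p.1 r.1),
      Equiv.apply_symm_apply, List.map_map, Equiv.self_comp_symm, List.map_id, stairContour, dif_pos hblk', baseEmb,
      transport_pmap (fun s t : Fin (d + 1) → ℤ => fieldLink F κ A (s + base n b.1.1) (t + base n b.1.1)),
      transport_comp (· + base n b.1.1) (fieldLink F κ A), ← stair_add]
    have h1 : (fun i => (n : ℤ) * (cellEquivY hb y).1 i) + base n b.1.1 = base n y.1.1 := by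
      funext i
      simp only [Pi.add_apply, cellEquivY_apply_val, Pi.sub_apply, base]
      ring
    have h2 : (cellEquivX hn hb x).1 + base n b.1.1 = x.1.1 := by rw [cellEquivX_apply_val, sub_add_cancel]
    rw [h1, h2]
  rw [hL, hR]

/-- **THE CARRIER BRIDGE**: for every bond `b = ⟨x, x + e_μ⟩ ⊂ Ω^{(k)}`, the bond term of (4.6) on [B4]'s region model
(r01's Neumann cell operator of the matching containing `b`, `B4Ineq46Lattice.bondTerm`, at `φ|_{{x,x′}}`) EQUALS the
left side of (4.7) on the two-block box of `B4Ineq410FirstOrder` (`lhs47Box`, base-corner block sites, staircase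
contours) for the translated field `A_x` and the translated `φ`:
`a_k|φ(x)|² + a_k|φ(x′)|² − a_k²⟨φ, Q_k(A)G_k(Δ(x,x′),A)Q_k^*(A)φ⟩` computed on the cell = computed on the box.
[cite: Balaban1983RegularityDecay, (4.6)–(4.7) p.590 «Δ(x,x′) = B^k(x) ∪ B^k(x′)»] -/
theorem bondTerm_eq_lhs47Box {n : ℕ} (hn : 1 ≤ n) (hb : b ∈ bonds Ω) (F : OrthFlow ι) (κ : ℝ) (m2 a : ℝ)
    (A : (Fin (d + 1) → ℤ) → (Fin (d + 1) → ℤ) → ℝ) (ψ : ↥Ω × ι → ℝ) :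
    bondTerm Ω (rblk hn Ω) (regWt n (fineDom n Ω)) m2 a (((n : ℝ) ^ (d + 1))⁻¹) (rBlkWt n Ω (fineDom n Ω))
        (fieldLink F κ fun u v : ↥(fineDom n Ω) => A u.1 v.1)
        (contourTrans (fieldLink F κ fun u v : ↥(fineDom n Ω) => A u.1 v.1) (rbaseEmb hn Ω) (rstairContour hn Ω)) b ψ
      = lhs47Box F κ n a m2 b.2 (baseEmb hn (twoBlk b.2)) (stairContour hn (twoBlk b.2))
          (shiftBond n b.1.1 A fun i => n * twoBlk b.2 i) (shiftCfg hb ψ) := by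
  have hr : (Real.sqrt ((n : ℝ) ^ (d + 1)))⁻¹ * (Real.sqrt ((n : ℝ) ^ (d + 1)))⁻¹ = ((n : ℝ) ^ (d + 1))⁻¹ := by
    rw [← mul_inv, Real.mul_self_sqrt (by positivity)]
  rw [bondTerm, keffCell, keff_congr _ _ _ _ _ (fun y x hyx => cell_contourTrans hn hb F κ A y x hyx),
    show WR (lab Ω (cls b) ∘ rblk hn Ω) (fieldLink F κ fun u v : ↥(fineDom n Ω) => A u.1 v.1) b.1
      = fieldLink F κ (fun u v : XC (lab Ω (cls b) ∘ rblk hn Ω) b.1 => A u.1.1 v.1.1) from rfl,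
    ← lhs47_eq_keff_form F κ _ m2 a _ _ _ _ _ hr]
  -- every datum is the box datum pulled back along the translations
  have hq' : (fun y x => (Real.sqrt ((n : ℝ) ^ (d + 1)))⁻¹
        * qR (lab Ω (cls b) ∘ rblk hn Ω) (lab Ω (cls b)) (rBlkWt n Ω (fineDom n Ω)) b.1 y x)
      = fun y x => outWtB n b.2 (cellEquivY hb y) (cellEquivX hn hb x) := by
    funext y x; exact (outWtB_cellEquiv hn hb y x).symm
  have hc : cR (lab Ω (cls b) ∘ rblk hn Ω) (regWt n (fineDom n Ω)) b.1
      = fun u v => boxWt n (fun i => n * twoBlk b.2 i) (cellEquivX hn hb u) (cellEquivX hn hb v) := by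
    funext u v; exact (boxWt_cellEquivX hn hb u v).symm
  have hq : qR (lab Ω (cls b) ∘ rblk hn Ω) (lab Ω (cls b)) (rBlkWt n Ω (fineDom n Ω)) b.1
      = fun y x => blkWt n (twoBlk b.2) (fun i => n * twoBlk b.2 i) (cellEquivY hb y) (cellEquivX hn hb x) := by
    funext y x; exact (blkWt_cellEquiv hn hb y x).symm
  have hA : (fun u v : XC (lab Ω (cls b) ∘ rblk hn Ω) b.1 => A u.1.1 v.1.1)
      = fun u v => shiftBond n b.1.1 A (fun i => n * twoBlk b.2 i) (cellEquivX hn hb u) (cellEquivX hn hb v) := by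
    funext u v
    simp only [shiftBond, cellEquivX_apply_val, sub_add_cancel]
  have hΨ : ψR (lab Ω (cls b)) b.1 ψ = fun p => shiftCfg hb ψ (cellEquivY hb p.1, p.2) := by
    funext p
    simp only [shiftCfg, Equiv.symm_apply_apply]
    rfl
  rw [hq', hc, hq, hA, hΨ]
  exact lhs47_reindex (cellEquivX hn hb) (cellEquivY hb) F κ _ m2 _ _ _ _ _ a _ _

end Bridge

/-! ## §4. The bond transporter `U(A(⟨x,x′⟩))` of (1.22)/(4.7), the covariant bond sum of (1.22) as a sum over the bonds
of `Ω^{(k)}`, and the regularity (1.21) on `Δ(x,x′)`: «A = A₀ + A′, A₀ = A(y₀) for some y₀ ∈ Δ(x,x′), and |A′|,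
|∂^η_μA′| ≤ O(1)p(e) on Δ(x,x′)» with `y₀ = n·x` -/

section BondData

variable {d : ℕ} {ι : Type} [Fintype ι] [DecidableEq ι]

/-- **`U(A(⟨x,x′⟩))` IS THE TRANSPORT ALONG THE BOND CONTOUR OF THE TRANSLATED FIELD**: the transporter of
`B4Ineq47TwoBlock.ineq47_box_canonical` (along `bondContour`, the straight contour `n·0 → n·e_μ` of the box) for the
field `A_x` is the unit-lattice link `U(A(⟨x, x+e_μ⟩))` of (1.22) (`B4Prop31Holonomy.clink`, the transport along the
`n` fine bonds from `n·x` to `n·(x+e_μ)`). [cite: Balaban1983RegularityDecay, (4.7) p.590 «U(A(⟨x,x′⟩))», (1.22) p.574] -/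
theorem transport_bondContour_shiftBond {n : ℕ} (hn : 1 ≤ n) (F : OrthFlow ι) (κ : ℝ)
    (Ac : (Fin (d + 1) → ℤ) → Fin (d + 1) → ℝ) (x₀ : Fin (d + 1) → ℤ) (μ : Fin (d + 1)) :
    transport (fieldLink F κ (shiftBond n x₀ (compField Ac) fun i => n * twoBlk μ i)) (baseEmb hn (twoBlk μ) (siteX μ))
        (bondContour hn μ) = clink F κ Ac n x₀ μ := by
  rw [bondContour, clink]
  show transport (fun u v : ↥(boxDom (fun i => n * twoBlk μ i)) =>
      (fun s t : Fin (d + 1) → ℤ => fieldLink F κ (compField Ac) (s + base n x₀) (t + base n x₀)) u.1 v.1)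
      ⟨base n (siteX μ).1, _⟩ ((stair (base n (siteX μ).1) (base n (siteX' μ).1)).pmap Subtype.mk _) = _
  rw [transport_pmap (fun s t : Fin (d + 1) → ℤ => fieldLink F κ (compField Ac) (s + base n x₀) (t + base n x₀)),
    transport_comp (· + base n x₀) (fieldLink F κ (compField Ac)), ← stair_add]
  have h0 : base n (siteX μ).1 + base n x₀ = base n x₀ := by
    funext i; simp [base, siteX]
  have h1 : base n (siteX' μ).1 + base n x₀ = base n x₀ + n • e1 μ := by
    funext i
    show (n : ℤ) * (Pi.single μ (1 : ℤ) : Fin (d + 1) → ℤ) i + (n : ℤ) * x₀ i = (n : ℤ) * x₀ i + (n • e1 μ) i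
    rw [Pi.smul_apply, nsmul_eq_mul, add_comm, e1]
  rw [h0, h1, stair_add_nsmul]

variable {Ωc : Finset (Fin (d + 1) → ℤ)}

/-- **THE COVARIANT BOND TERM `|U(A(⟨x,x′⟩))φ(x′) − φ(x)|²` OF (1.22)/(4.7)** at the bond `b = ⟨x, x + e_μ⟩` (`0` when
`x + e_μ ∉ Ω^{(k)}`). [cite: Balaban1983RegularityDecay, (1.22) p.574, (4.7) p.590] -/
def bondDiffSq (F : OrthFlow ι) (κ : ℝ) (Ac : (Fin (d + 1) → ℤ) → Fin (d + 1) → ℝ) (n : ℕ) (ψ : ↥Ωc × ι → ℝ)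
    (b : ↥Ωc × Fin (d + 1)) : ℝ :=
  if h : b.1.1 + e1 b.2 ∈ Ωc then
    (clink F κ Ac n b.1.1 b.2 *ᵥ fld ψ ⟨b.1.1 + e1 b.2, h⟩ - fld ψ b.1) ⬝ᵥ
      (clink F κ Ac n b.1.1 b.2 *ᵥ fld ψ ⟨b.1.1 + e1 b.2, h⟩ - fld ψ b.1)
  else 0

/-- the covariant bond term is non-negative. [cite: Balaban1983RegularityDecay, (1.22) p.574] -/
theorem bondDiffSq_nonneg (F : OrthFlow ι) (κ : ℝ) (Ac : (Fin (d + 1) → ℤ) → Fin (d + 1) → ℝ) (n : ℕ)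
    (ψ : ↥Ωc × ι → ℝ) (b : ↥Ωc × Fin (d + 1)) : 0 ≤ bondDiffSq F κ Ac n ψ b := by
  unfold bondDiffSq
  split_ifs
  · exact dotProduct_self_nonneg' _
  · exact le_rfl

/-- the covariant bond term at a bond of `Ω^{(k)}`. [cite: Balaban1983RegularityDecay, (1.22) p.574, (4.7) p.590] -/
theorem bondDiffSq_of_mem (F : OrthFlow ι) (κ : ℝ) (Ac : (Fin (d + 1) → ℤ) → Fin (d + 1) → ℝ) (n : ℕ)
    (ψ : ↥Ωc × ι → ℝ) {b : ↥Ωc × Fin (d + 1)} (hb : b ∈ bonds Ωc) :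
    bondDiffSq F κ Ac n ψ b = (clink F κ Ac n b.1.1 b.2 *ᵥ fld ψ ⟨b.1.1 + e1 b.2, mem_bonds.1 hb⟩ - fld ψ b.1) ⬝ᵥ
      (clink F κ Ac n b.1.1 b.2 *ᵥ fld ψ ⟨b.1.1 + e1 b.2, mem_bonds.1 hb⟩ - fld ψ b.1) := by
  unfold bondDiffSq
  rw [dif_pos (mem_bonds.1 hb)]

/-- **THE COVARIANT BOND SUM OF (1.22) IS THE SUM OF THE BOND TERMS OVER THE POSITIVELY ORIENTED BONDS OF `Ω^{(k)}`**:
`Σ_{⟨x,x′⟩⊂Ω^{(k)}} |U(A(⟨x,x′⟩))φ(x′) − φ(x)|² = Σ_{b ∈ bonds Ω} bondDiffSq b` (p35's `covDiffSq` of the typed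
carrier ↔ the bond set of `B4Ineq46Lattice`). [cite: Balaban1983RegularityDecay, (1.22) p.574] -/
theorem covDiffSq_eq_sum_bonds (F : OrthFlow ι) (κ : ℝ) (Ac : (Fin (d + 1) → ℤ) → Fin (d + 1) → ℝ) (n : ℕ)
    (ψ : ↥Ωc × ι → ℝ) : covDiffSq F κ Ac n Ωc ψ = ∑ b ∈ bonds Ωc, bondDiffSq F κ Ac n ψ b := by
  unfold covDiffSq bonds
  rw [Finset.sum_filter, Fintype.sum_prod_type]
  refine Finset.sum_congr rfl fun y _ => Finset.sum_congr rfl fun μ _ => ?_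
  dsimp only
  by_cases h : y.1 + e1 μ ∈ Ωc
  · rw [dif_pos h, if_pos h, bondDiffSq, dif_pos h]
  · rw [dif_neg h, if_neg h]

/-- **(1.21) ON THE TWO-BLOCK REGION**: if `|A_ν(z + e_μ) − A_ν(z)| ≤ δ` on `Ω` then for every fine point `w` of
`Δ(x,x′) = B^k(x) ∪ B^k(x′)` (`⟨x,x′⟩ ⊂ Ω^{(k)}`), `|A_ν(w) − A_ν(n·x)| ≤ (d+2)·n·δ` — «A₀ = A(y₀) for some
y₀ ∈ Δ(x,x′), and |A′| ≤ O(1)p(e) on Δ(x,x′)» with `y₀ = n·x` (the staircase from the base corner of the block of `w`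
has `≤ (d+1)n` steps, plus `n` steps from `n·x` to `n·x′`). [cite: Balaban1983RegularityDecay, p.590 «A₀ = A(y₀) for some y₀ ∈ Δ(x,x′), and |A′|, |∂^η_μA′| ≤ O(1)p(e) on Δ(x,x′)»] -/
theorem abs_sub_corner_le {n : ℕ} (hn : 1 ≤ n) {Ac : (Fin (d + 1) → ℤ) → Fin (d + 1) → ℝ} {δ : ℝ} (hδ : 0 ≤ δ)
    (h121 : ∀ x ∈ fineDom n Ωc, ∀ μ ν : Fin (d + 1), |Ac (x + e1 μ) ν - Ac x ν| ≤ δ) {b : ↥Ωc × Fin (d + 1)}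
    (hb : b ∈ bonds Ωc) {w : Fin (d + 1) → ℤ} (hw : blk n w = b.1.1 ∨ blk n w = b.1.1 + e1 b.2) (ν : Fin (d + 1)) :
    |Ac w ν - Ac (base n b.1.1) ν| ≤ ((d : ℝ) + 2) * n * δ := by
  have hnδ : 0 ≤ (n : ℝ) * δ := by positivity
  rcases hw with hw | hw
  · have hwR : w ∈ fineDom n Ωc := by rw [mem_fineDom hn, hw]; exact b.1.2
    have h := abs_comp_sub_base_le hn Ωc hδ h121 hwR ν
    rw [hw] at h
    exact h.trans (by nlinarith)
  · have hwR : w ∈ fineDom n Ωc := by rw [mem_fineDom hn, hw]; exact mem_bonds.1 hb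
    have h := abs_comp_sub_base_le hn Ωc hδ h121 hwR ν
    rw [hw] at h
    have he : (fun i => (n : ℤ) * (b.1.1 + e1 b.2) i) = base n b.1.1 + n • e1 b.2 := base_add_e1 n b.1.1 b.2
    rw [he] at h
    have h' : |Ac (base n b.1.1 + n • e1 b.2) ν - Ac (base n b.1.1) ν| ≤ n * δ :=
      abs_sub_nsmul_le Ωc h121 (base n b.1.1) b.2 ν n
        (fun t ht => by rw [mem_fineDom hn, blk_base_add_nsmul hn b.1.1 b.2 ht]; exact b.1.2)
    calc |Ac w ν - Ac (base n b.1.1) ν|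
        ≤ |Ac w ν - Ac (base n b.1.1 + n • e1 b.2) ν| + |Ac (base n b.1.1 + n • e1 b.2) ν - Ac (base n b.1.1) ν| :=
          abs_sub_le _ _ _
      _ ≤ ((d : ℝ) + 1) * n * δ + n * δ := add_le_add h h'
      _ = ((d : ℝ) + 2) * n * δ := by ring

/-- **«|A′| ≤ O(1)p(e) on Δ(x,x′)» AS THE BOND BOUND OF `B4Ineq47TwoBlock.ineq47_box_canonical`**: with `A₀ = A(n·x)` and
`A′ = A_x − A₀` on the fine two-block box, `n|κA′_{uv}| ≤ n·|κ|·(d+2)nδ` on every nearest-neighbour pair (`δ` = the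
lattice-unit bound of (1.21) on `Ω`). [cite: Balaban1983RegularityDecay, p.590 «|A′|, |∂^η_μA′| ≤ O(1)p(e) on Δ(x,x′)»] -/
theorem shiftBond_sub_const_small {n : ℕ} (hn : 1 ≤ n) {Ac : (Fin (d + 1) → ℤ) → Fin (d + 1) → ℝ} {δ : ℝ}
    (hδ : 0 ≤ δ) (h121 : ∀ x ∈ fineDom n Ωc, ∀ μ ν : Fin (d + 1), |Ac (x + e1 μ) ν - Ac x ν| ≤ δ)
    {b : ↥Ωc × Fin (d + 1)} (hb : b ∈ bonds Ωc) (κ : ℝ) (u v : ↥(boxDom (fun i => n * twoBlk b.2 i)))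
    (huv : v.1 ∈ nbrs u.1) :
    (n : ℝ) * |κ * (shiftBond n b.1.1 (compField Ac) (fun i => n * twoBlk b.2 i) u v
        - constBond (Ac (base n b.1.1)) Subtype.val u v)| ≤ (n : ℝ) * (|κ| * (((d : ℝ) + 2) * n * δ)) := by
  rw [abs_mul]
  refine mul_le_mul_of_nonneg_left (mul_le_mul_of_nonneg_left ?_ (abs_nonneg κ)) (Nat.cast_nonneg n)
  obtain ⟨i, h | h⟩ := mem_nbrs.1 huv
  · have h' : v.1 = u.1 + e1 i := h
    have hA : shiftBond n b.1.1 (compField Ac) (fun i => n * twoBlk b.2 i) u v = Ac (u.1 + base n b.1.1) i := by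
      show compField Ac (u.1 + base n b.1.1) (v.1 + base n b.1.1) = _
      rw [h', add_right_comm, compField_add]
    rw [hA, constBond_step _ h']
    exact abs_sub_corner_le hn hδ h121 hb (blk_add_of_boxDom_fine hn b u) i
  · have h' : u.1 = v.1 + e1 i := by rw [h, e1, sub_add_cancel]
    have hA : shiftBond n b.1.1 (compField Ac) (fun i => n * twoBlk b.2 i) u v = -Ac (v.1 + base n b.1.1) i := by
      show compField Ac (u.1 + base n b.1.1) (v.1 + base n b.1.1) = _
      rw [h', add_right_comm, compField_sub]
    rw [hA, constBond_step_rev _ h', neg_sub_neg, abs_sub_comm]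
    exact abs_sub_corner_le hn hδ h121 hb (blk_add_of_boxDom_fine hn b v) i

end BondData

/-! ## §5. (1.22) in lattice units by the printed route: (4.7) on every `Δ(x,x′)` [⇐ (4.11)+(4.12)+(4.13)] fed, bond by
bond, into «to prove (1.18) it is sufficient to prove (4.7) … γ₀ = ½ min{γ₀′/2d, a_k/(a_k+O(1))}» [(4.4) + (4.6)] -/

section Lattice

variable {ι : Type} [Fintype ι] [DecidableEq ι]

/-- **(1.22) IN LATTICE UNITS BY THE PRINTED ROUTE OF §4, EXPLICIT CONSTANTS**: for the flow `e^{tq}` (`qᵀ = −q`),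
`a_k > 0`, `m² ≥ 0` there are `γ₀ > 0`, `K ≥ 0` (depending on `d`, `q`, `a_k`, `m²` only: `γ₀ = ½ min{γ₀′/2(d+1),
a_k/(a_k+m²)}` with the `γ₀′` of (4.7) (`B4Ineq47TwoBlock.ineq47_box_canonical`), `K = ½C′` with `C′` its error constant) such that for
EVERY mesh `n ≥ 1`, coupling `κ`, finite `Ω^{(k)} ⊂ ℤ^{d+1}`, vector field `A_ν` with (1.21) in lattice units
`|A_ν(z + e_μ) − A_ν(z)| ≤ δ` on `Ω`, under the Lemma-2.1 smallness of `ε₁ = n|κ|(d+2)nδ` (`= (d+2)·O(1)·e·p(e)` for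
`κ = eη`, `δ = O(1)p(e)η`), and every `φ`:
`γ₀(Σ_{⟨x,x′⟩⊂Ω^{(k)}}|U(A(⟨x,x′⟩))φ(x′) − φ(x)|² + m²Σ|φ|²) − Kε₁²Σ|φ|² ≤ ⟨φ, Δ^{(k)}(Ω,A)φ⟩`.  Proof = the print's
§4: (4.7) on each two-block cell `Δ(x,x′)` with `A₀ = A(n·x)` (`ineq47_box_canonical` through the carrier bridge
`bondTerm_eq_lhs47Box`, `transport_bondContour_shiftBond`, `shiftBond_sub_const_small`), then (4.4) + (4.6) and the
averaging «γ₀ = ½ min{…}» (`B4Ineq44MassPart.prop31_region_of_ineq47`).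
[cite: Balaban1983RegularityDecay, (1.22) p.574; proof §4 pp.589–591, (4.4), (4.6), (4.7), (4.11)–(4.13)] -/
theorem form122_sect4_lattice (d : ℕ) (q : Matrix ι ι ℝ) (hq : qᵀ = -q) {a : ℝ} (ha : 0 < a) {m2 : ℝ} (hm : 0 ≤ m2) :
    ∃ γ₀ K : ℝ, 0 < γ₀ ∧ 0 ≤ K ∧ ∀ (n : ℕ) (hn : 1 ≤ n) (κ : ℝ) (Ωc : Finset (Fin (d + 1) → ℤ))
      (Ac : (Fin (d + 1) → ℤ) → Fin (d + 1) → ℝ) (δ : ℝ), 0 ≤ δ →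
      (∀ x ∈ fineDom n Ωc, ∀ μ ν : Fin (d + 1), |Ac (x + e1 μ) ν - Ac x ν| ≤ δ) →
      (∑ i, ∑ j, q i j ^ 2) * ((n : ℝ) * (|κ| * (((d : ℝ) + 2) * n * δ))) ^ 2 * ((d : ℝ) + 1)
          * (1 + a * ((d : ℝ) + 1)) ≤ min 2 a / 4 →
      ∀ ψ : ↥Ωc × ι → ℝ,
        γ₀ * (covDiffSq (expFlow q hq) κ Ac n Ωc ψ + m2 * (ψ ⬝ᵥ ψ))
            - K * ((n : ℝ) * (|κ| * (((d : ℝ) + 2) * n * δ))) ^ 2 * (ψ ⬝ᵥ ψ)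
          ≤ ψ ⬝ᵥ (keff (regWt n (fineDom n Ωc)) m2 a (((n : ℝ) ^ (d + 1))⁻¹) (rBlkWt n Ωc (fineDom n Ωc))
              (linkR (expFlow q hq) κ n Ωc Ac) (transR (expFlow q hq) κ hn Ωc Ac) *ᵥ ψ) := by
  obtain ⟨γ, C, hγ, hC, h47⟩ := ineq47_box_canonical d q hq a a m2 ha
  have hγ₀ : 0 < min (γ / (2 * ((d : ℝ) + 1))) (a / (a + m2)) / 2 :=
    half_pos (lt_min (by positivity) (div_pos ha (by linarith)))
  refine ⟨min (γ / (2 * ((d : ℝ) + 1))) (a / (a + m2)) / 2, C / 2, hγ₀, by positivity, ?_⟩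
  intro n hn κ Ωc Ac δ hδ h121 hsmall ψ
  set ε₁ : ℝ := (n : ℝ) * (|κ| * (((d : ℝ) + 2) * n * δ)) with hε₁
  have hε₁0 : 0 ≤ ε₁ := by positivity
  -- (4.7) on the cell of every bond
  have hbond : ∀ b ∈ bonds Ωc, γ * bondDiffSq (expFlow q hq) κ Ac n ψ b - C * ε₁ ^ 2 * endSq Ωc ψ b ≤
      bondTerm Ωc (rblk hn Ωc) (regWt n (fineDom n Ωc)) m2 a (((n : ℝ) ^ (d + 1))⁻¹) (rBlkWt n Ωc (fineDom n Ωc))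
        (fieldLink (expFlow q hq) κ fun u v : ↥(fineDom n Ωc) => compField Ac u.1 v.1)
        (contourTrans (fieldLink (expFlow q hq) κ fun u v : ↥(fineDom n Ωc) => compField Ac u.1 v.1)
          (rbaseEmb hn Ωc) (rstairContour hn Ωc)) b ψ := by
    intro b hb
    rw [bondTerm_eq_lhs47Box hn hb]
    have h := h47 n hn a m2 le_rfl le_rfl hm le_rfl b.2 κ (Ac (base n b.1.1))
      (fun u v => shiftBond n b.1.1 (compField Ac) (fun i => n * twoBlk b.2 i) u v
        - constBond (Ac (base n b.1.1)) Subtype.val u v)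
      ε₁ hε₁0 (fun u v huv => shiftBond_sub_const_small hn hδ h121 hb κ u v huv) hsmall (shiftCfg hb ψ)
    have hsum : (constBond (Ac (base n b.1.1)) Subtype.val
        + fun u v => shiftBond n b.1.1 (compField Ac) (fun i => n * twoBlk b.2 i) u v
          - constBond (Ac (base n b.1.1)) Subtype.val u v)
        = shiftBond n b.1.1 (compField Ac) (fun i => n * twoBlk b.2 i) := by
      funext u v
      simp only [Pi.add_apply]
      ring
    rw [hsum, transport_bondContour_shiftBond hn (expFlow q hq) κ Ac b.1.1 b.2, siteNorm_sq, siteNorm_sq, siteNorm_sq,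
      fld_shiftCfg_siteX hb, fld_shiftCfg_siteX' hb] at h
    rw [bondDiffSq_of_mem _ _ _ _ _ hb, endSq, sqAt_of_mem Ωc ψ ⟨b.1.1 + e1 b.2, mem_bonds.1 hb⟩]
    exact h
  -- (4.4) + (4.6) + averaging
  have key := prop31_region_of_ineq47 (expFlow q hq) κ hn Ωc hm ha (compField Ac) ψ (bondDiffSq (expFlow q hq) κ Ac n ψ)
    (fun b _ => bondDiffSq_nonneg _ _ _ _ _ b) (γ' := γ) (E := C * ε₁ ^ 2) (by positivity) hbond
  rw [← covDiffSq_eq_sum_bonds] at key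
  have key' : min (γ / (2 * ((d : ℝ) + 1))) (a / (a + m2)) / 2
        * (covDiffSq (expFlow q hq) κ Ac n Ωc ψ + m2 * (ψ ⬝ᵥ ψ)) - C * ε₁ ^ 2 / 2 * (ψ ⬝ᵥ ψ)
      ≤ ψ ⬝ᵥ (keff (regWt n (fineDom n Ωc)) m2 a (((n : ℝ) ^ (d + 1))⁻¹) (rBlkWt n Ωc (fineDom n Ωc))
          (linkR (expFlow q hq) κ n Ωc Ac) (transR (expFlow q hq) κ hn Ωc Ac) *ᵥ ψ) := key
  have e : C / 2 * ε₁ ^ 2 * (ψ ⬝ᵥ ψ) = C * ε₁ ^ 2 / 2 * (ψ ⬝ᵥ ψ) := by ring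
  linarith [key', e]

end Lattice

/-! ## §6. The typed «Proposition 3.1′ of [2]» `B4.Prop31Printed` on p35's regular-region family, by the printed route -/

section Family

variable {ι : Type} [Fintype ι] [DecidableEq ι] {d : ℕ}

/-- **THEOREM («PROPOSITION 3.1′ OF [2]» (1.21)–(1.22), TYPED `B4.Prop31Printed`, PROVED BY THE PRINTED §4 ROUTE ON THE
REGULAR-REGION FAMILY)** — for the flow `e^{tq}` of (1.2) (`qᵀ = −q`), `a_k > 0`, `m² ≥ 0`, `O(1) = C ≥ 0`, `a₀ ≥ 0`,
`p > 0`: `B4.Prop31Printed (B4Prop31Regular.regularFormSetting (expFlow q hq) a m² C a₀ p)` — every mesh `η = 1/n`,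
every finite `Ω^{(k)} ⊂ ℤ^{d+1}` («Ω a sum of unit blocks»), every charge `0 < e ≤ e₁`, every vector field with (1.21)
`|(∂^η_μA)(x)| ≤ O(1)p(e)`, `p(e) = a₀(1 + log e^{−1})^p`.  Witnesses: `γ₀ = ½ min{γ₀′/2(d+1), a_k/(a_k+m²)}` (print:
«γ₀ = ½ min{γ₀′/2d, a_k/(a_k+O(1))}»), `e₁ = min(1, e₁′)` with `e₁′` the Lemma-2.1 threshold for
`ε₁ ≤ (d+2)·C·a₀·max(1,2p)^p·e^{1/2}` (`B4Lower18Regular.threshold_exists`), and `O(1) = C(α) = K·((d+2)Ca₀)²·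
max(1,2p/α)^{2p}` in front of `e^{2−α}` (from the printed `O(1)e²p²(e)`: `(1 + log e⁻¹)^{2p}e^{α} ≤ max(1,2p/α)^{2p}`).
This is the SECOND kernel proof of the typed leaf on this family: p35's `B4Prop31Regular.prop31Printed_regularRegion`
proves it by a global variational route (holonomy of prisms); this one follows the print's §4 — (4.4), the `2d`
matchings and (4.6), and (4.7) on each `Δ(x,x′)` via (4.8)–(4.13).  HONEST LABEL: `γ₀` depends on `(d, q, a_k, m²)`
(print: «depending on d only»; the printed proof's own «a_k/(a_k+O(1))», «if m² ≤ O(1)»).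
[cite: Balaban1983RegularityDecay, Prop. 3.1′ of [2] (1.21)–(1.22) p.574; proof §4 pp.589–591] -/
theorem prop31Printed_regularRegion_sect4 (q : Matrix ι ι ℝ) (hq : qᵀ = -q) {a : ℝ} (ha : 0 < a) {m2 : ℝ}
    (hm : 0 ≤ m2) {C : ℝ} (hC : 0 ≤ C) {a₀ : ℝ} (ha₀ : 0 ≤ a₀) {p : ℝ} (hp : 0 < p) :
    B4.Prop31Printed (regularFormSetting (d := d) (expFlow q hq) a m2 C a₀ p) := by
  obtain ⟨γ₀, K, hγ₀, hK, hlat⟩ := form122_sect4_lattice d q hq ha hm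
  set c' : ℝ := ((d : ℝ) + 2) * C * (a₀ * max 1 (p / (1 / 2)) ^ p) with hc'
  obtain ⟨e₁, he₁, hsm⟩ := threshold_exists (Real.sqrt (∑ i, ∑ j, q i j ^ 2)) c' ha (β := (1 / 2 : ℝ)) (by norm_num) d
  refine ⟨γ₀, min 1 e₁, hγ₀, lt_min one_pos he₁, fun α hα => ?_⟩
  set Cα : ℝ := K * ((((d : ℝ) + 2) * C * a₀) ^ 2 * max 1 (2 * p / α) ^ (2 * p)) with hCα
  refine ⟨Cα, by positivity, ?_⟩
  intro i _ hreg he hle ψ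
  change 0 < i.e at he
  change i.e ≤ min 1 e₁ at hle
  change ∀ x ∈ fineDom i.n i.Ωc, ∀ μ ν : Fin (d + 1),
    |i.Ac (x + e1 μ) ν - i.Ac x ν| ≤ C * B2.pFn a₀ p i.e / i.n at hreg
  have he1 : i.e ≤ 1 := hle.trans (min_le_left _ _)
  have hle' : i.e ≤ e₁ := hle.trans (min_le_right _ _)
  have hn0 : (0 : ℝ) < i.n := by exact_mod_cast i.hn
  -- the logarithmic factor of (1.21)
  set Lg : ℝ := 1 + Real.log i.e⁻¹ with hLg
  have hLg0 : 0 ≤ Lg := by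
    rw [hLg, Real.log_inv]
    have := Real.log_nonpos he.le he1
    linarith
  have hpFn : B2.pFn a₀ p i.e = a₀ * Lg ^ p := rfl
  rw [hpFn] at hreg
  set δ : ℝ := C * (a₀ * Lg ^ p) / i.n with hδ_def
  have hδ : 0 ≤ δ := by positivity
  -- ε₁ = n·|κ|·(d+2)nδ = (d+2)·C·a₀·e·(1 + log e⁻¹)^p
  have hκ : |i.e / i.n| = i.e / i.n := abs_of_pos (div_pos he hn0)
  have hε : (i.n : ℝ) * (|i.e / (i.n : ℝ)| * (((d : ℝ) + 2) * i.n * δ)) = ((d : ℝ) + 2) * C * a₀ * (i.e * Lg ^ p) := by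
    rw [hκ, hδ_def]
    field_simp
  have hε0 : 0 ≤ (i.n : ℝ) * (|i.e / (i.n : ℝ)| * (((d : ℝ) + 2) * i.n * δ)) := by positivity
  have hlog1 := one_add_log_inv_rpow_mul_rpow_le hp (by norm_num : (0 : ℝ) < 1 / 2) he he1
  have hesplit : i.e = i.e ^ (1 / 2 : ℝ) * i.e ^ (1 / 2 : ℝ) := by
    rw [← Real.rpow_add he]
    norm_num
  have hεθ : (i.n : ℝ) * (|i.e / (i.n : ℝ)| * (((d : ℝ) + 2) * i.n * δ)) ≤ c' * i.e ^ (1 / 2 : ℝ) := by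
    rw [hε, hc']
    have key : i.e * Lg ^ p ≤ max 1 (p / (1 / 2)) ^ p * i.e ^ (1 / 2 : ℝ) := by
      calc i.e * Lg ^ p = (Lg ^ p * i.e ^ (1 / 2 : ℝ)) * i.e ^ (1 / 2 : ℝ) := by
            conv_lhs => rw [hesplit]
            ring
        _ ≤ max 1 (p / (1 / 2)) ^ p * i.e ^ (1 / 2 : ℝ) :=
            mul_le_mul_of_nonneg_right hlog1 (Real.rpow_nonneg he.le _)
    have h0 : 0 ≤ ((d : ℝ) + 2) * C * a₀ := by positivity
    calc ((d : ℝ) + 2) * C * a₀ * (i.e * Lg ^ p)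
        ≤ ((d : ℝ) + 2) * C * a₀ * (max 1 (p / (1 / 2)) ^ p * i.e ^ (1 / 2 : ℝ)) := mul_le_mul_of_nonneg_left key h0
      _ = ((d : ℝ) + 2) * C * (a₀ * max 1 (p / (1 / 2)) ^ p) * i.e ^ (1 / 2 : ℝ) := by ring
  -- the Lemma-2.1 smallness «e sufficiently small»
  have hsmall : (∑ k, ∑ j, q k j ^ 2) * ((i.n : ℝ) * (|i.e / (i.n : ℝ)| * (((d : ℝ) + 2) * i.n * δ))) ^ 2
      * ((d : ℝ) + 1) * (1 + a * ((d : ℝ) + 1)) ≤ min 2 a / 4 := by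
    have h := hsm i.e he hle'
    rw [Real.sq_sqrt (by positivity)] at h
    refine le_trans ?_ h
    have hsq : ((i.n : ℝ) * (|i.e / (i.n : ℝ)| * (((d : ℝ) + 2) * i.n * δ))) ^ 2 ≤ (c' * i.e ^ (1 / 2 : ℝ)) ^ 2 :=
      pow_le_pow_left₀ hε0 hεθ 2
    have hℓ : 0 ≤ ∑ k, ∑ j, q k j ^ 2 := by positivity
    have hd1 : 0 ≤ (d : ℝ) + 1 := by positivity
    have hX : 0 ≤ 1 + a * ((d : ℝ) + 1) := by positivity
    exact mul_le_mul_of_nonneg_right (mul_le_mul_of_nonneg_right (mul_le_mul_of_nonneg_left hsq hℓ) hd1) hX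
  -- the lattice (1.22) by the printed route
  have key := hlat i.n i.hn (i.e / i.n) i.Ωc i.Ac δ hδ hreg hsmall ψ
  -- the error coefficient is ≤ C(α) e^{2−α}
  have hlog2 := one_add_log_inv_rpow_mul_rpow_le (p := 2 * p) (s := α) (by positivity) hα he he1
  have herr : (i.e * Lg ^ p) ^ 2 ≤ max 1 (2 * p / α) ^ (2 * p) * i.e ^ ((2 : ℝ) - α) := by
    have hsq : (Lg ^ p) ^ 2 = Lg ^ (2 * p) := by
      rw [show (2 : ℝ) * p = p * 2 by ring, Real.rpow_mul hLg0, Real.rpow_two]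
    have h2 : i.e ^ 2 = i.e ^ ((2 : ℝ) - α) * i.e ^ α := by
      rw [← Real.rpow_add he, sub_add_cancel, Real.rpow_two]
    rw [mul_pow, hsq, h2]
    calc i.e ^ ((2 : ℝ) - α) * i.e ^ α * Lg ^ (2 * p) = (Lg ^ (2 * p) * i.e ^ α) * i.e ^ ((2 : ℝ) - α) := by ring
      _ ≤ max 1 (2 * p / α) ^ (2 * p) * i.e ^ ((2 : ℝ) - α) :=
          mul_le_mul_of_nonneg_right hlog2 (Real.rpow_nonneg he.le _)
  have hcoef : K * ((i.n : ℝ) * (|i.e / (i.n : ℝ)| * (((d : ℝ) + 2) * i.n * δ))) ^ 2 ≤ Cα * i.e ^ ((2 : ℝ) - α) := by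
    rw [hε, mul_pow, hCα]
    have h0 : 0 ≤ K * (((d : ℝ) + 2) * C * a₀) ^ 2 := by positivity
    have := mul_le_mul_of_nonneg_left herr h0
    calc K * ((((d : ℝ) + 2) * C * a₀) ^ 2 * (i.e * Lg ^ p) ^ 2)
        = K * (((d : ℝ) + 2) * C * a₀) ^ 2 * (i.e * Lg ^ p) ^ 2 := by ring
      _ ≤ K * (((d : ℝ) + 2) * C * a₀) ^ 2 * (max 1 (2 * p / α) ^ (2 * p) * i.e ^ ((2 : ℝ) - α)) := this
      _ = K * ((((d : ℝ) + 2) * C * a₀) ^ 2 * max 1 (2 * p / α) ^ (2 * p)) * i.e ^ ((2 : ℝ) - α) := by ring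
  have hS : 0 ≤ ψ ⬝ᵥ ψ := dotProduct_self_nonneg' ψ
  have hprod := mul_le_mul_of_nonneg_right hcoef hS
  change γ₀ * (covDiffSq (expFlow q hq) (i.e / i.n) i.Ac i.n i.Ωc ψ + m2 * (ψ ⬝ᵥ ψ))
      - Cα * i.e ^ ((2 : ℝ) - α) * (ψ ⬝ᵥ ψ)
    ≤ ψ ⬝ᵥ (keff (regWt i.n (fineDom i.n i.Ωc)) m2 a ((i.n : ℝ) ^ (d + 1))⁻¹
      (rBlkWt i.n i.Ωc (fineDom i.n i.Ωc)) (linkR (expFlow q hq) (i.e / i.n) i.n i.Ωc i.Ac)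
      (transR (expFlow q hq) (i.e / i.n) i.hn i.Ωc i.Ac) *ᵥ ψ)
  linarith [key, hprod]

end Family

end

end Literature.MathematicalPhysics.QuantumFieldTheory.Balaban1983to89.B4Prop31Sect4Route
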